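import Summits.PneNP.PneNP.Theorems.NegLimitedLadderFixedK
import Summits.PneNP.PneNP.Theorems.NegLimitedLadderRecurringCliqueSlices

/-!
# Route NegLimited — the rung `NeglimitedPolyVsEpsLogNegations` (R9-A′) of line `density-ladder` (rung F-N1/p3, ROUND-9 §B)

Helper file for the support item `NegLimited.NeglimitedLogOverOmegaNegations` (stmt-PneNP-19555):
the second rung the registered skeleton `density-ladder`
(HOME/pnp-ideate-p3/r9/ladder/density-ladder.lean, sha 2d55ebf8) records as a RESULT of the line,
`NeglimitedPolyVsEpsLogNegations` — the `∀ c ∃ L ∃ ε` quantifier swap of the door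
`NegLimited.NeglimitedEpsLogNegationsR` (`∃ L ∃ ε ∀ c`): for every polynomial `n^c` an explicit `NP`
language with monotone slices and an `ε > 0` such that De Morgan circuits with `⌊ε·log₂ n⌋` NOT
gates for it need more than `n^c` gates infinitely often.  PROVED here, in the uniform form (ONE
language for all `c`, `neglimitedPolyVsEpsLogNegations_uniform`), from the two landed pieces of the
line:
* the engine `NegLimitedLadder.neglimitedCliqueFixedK_holds` (`NegLimitedLadderFixedK.lean`, Rossman's
  fixed-`k` clique bound through the density ladder): for `k ≥ 5`, eventually every De Morgan circuit
  computing `CLIQUE(m, k)` with `≤ ⌊log₂ m⌋/k⁴` NOT gates has more than `m^{k/4} - 1` gates;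
* the slice plumbing `NegLimitedLadder.recCliqueLang` (`NegLimitedLadderRecurringCliqueSlices.lean`):
  ONE `NP` language whose slice at every length `m² + k` (`k < m`) is `CLIQUE(m, k)` of the square part.
Arithmetic: for `n^c` take `k = 16c + 17`, `ε = 1/(4k⁴)`; at `n = m² + k ≤ m⁴` the budget is
`⌊ε·log₂ n⌋ ≤ ⌊log₂ m / k⁴⌋ = ⌊log₂ m⌋ / k⁴` and the size bound is `m^{k/4} ≥ m^{4c+4} ≥ n^c + 2`.

References: B. Rossman, *The monotone complexity of k-clique on random graphs*, FOCS 2010, Thm. 1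
[Rossman2010]; B. Rossman, *Correlation bounds against monotone NC¹*, CCC 2015, Lemma 1.3/3.2
[Rossman2015]; S. Jukna, *Boolean Function Complexity* (2012), §10.5, Research Problem 10.23
[Jukna2012].
-/

set_option linter.dupNamespace false -- `Summit.PneNP.PneNP.…`: summit = sub-problem name (D-0017 single-conjunct layout)

namespace Summit.PneNP.PneNP.Theorems.NegLimitedLadder

open Finset Filter
open Literature.Computability.Complexity

/-- The rung `NeglimitedPolyVsEpsLogNegations` (R9-A′; verbatim from the registered skeleton
`density-ladder`): the `∀ c ∃ L ∃ ε` quantifier swap of the door — for every polynomial `n^c` an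
explicit NP language with monotone slices and an `ε > 0` such that De Morgan circuits with `⌊ε log₂ n⌋`
NOT gates for it need more than `n^c` gates infinitely often. -/
def NeglimitedPolyVsEpsLogNegations : Prop :=
  ∀ c : ℕ, ∃ L ∈ Literature.Computability.Complexity.Nondeterministic.NP, ∃ ε : ℝ, 0 < ε ∧
    ∃ᶠ n : ℕ in atTop, Monotone (L.sliceFn n) ∧
      n ^ c < negLimitedSizeOver deMorganBasis ⌊ε * Real.logb 2 n⌋₊ (L.sliceFn n)

/-! ## Arithmetic of the recurrence lengths `n = m² + k ≤ m⁴` -/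

/-- The recurrence length sits below the fourth power: `m² + k ≤ m⁴` for `2 ≤ m`, `k < m`. [folklore] -/
theorem sq_add_le_pow_four {m k : ℕ} (hm : 2 ≤ m) (hk : k < m) : m * m + k ≤ m ^ 4 := by
  have h4 : m ^ 4 = m * m * (m * m) := by ring
  rw [h4]
  nlinarith [Nat.le_mul_self m]

/-- **Budget comparison**: `⌊(1/(4k⁴))·log₂ n⌋ ≤ ⌊log₂ m⌋ / k⁴` for `1 ≤ n ≤ m⁴`. [folklore] -/
theorem floor_eps_logb_le_log_div {m k n : ℕ} (hn1 : 1 ≤ n) (hn : n ≤ m ^ 4) :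
    ⌊1 / (4 * (k : ℝ) ^ 4) * Real.logb 2 (n : ℝ)⌋₊ ≤ Nat.log 2 m / k ^ 4 := by
  rcases Nat.eq_zero_or_pos k with rfl | hk
  · simp
  have hkR : (0 : ℝ) < (k : ℝ) ^ 4 := by positivity
  have h1 : Real.logb 2 (n : ℝ) ≤ Real.logb 2 ((m : ℝ) ^ 4) :=
    Real.logb_le_logb_of_le one_lt_two (by exact_mod_cast hn1) (by exact_mod_cast hn)
  have h2 : Real.logb 2 ((m : ℝ) ^ 4) = 4 * Real.logb 2 m := by
    rw [Real.logb_pow]; norm_num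
  have h3 : 1 / (4 * (k : ℝ) ^ 4) * Real.logb 2 (n : ℝ) ≤ Real.logb 2 (m : ℝ) / ((k ^ 4 : ℕ) : ℝ) := by
    rw [Nat.cast_pow]
    calc 1 / (4 * (k : ℝ) ^ 4) * Real.logb 2 (n : ℝ)
        ≤ 1 / (4 * (k : ℝ) ^ 4) * (4 * Real.logb 2 m) :=
          mul_le_mul_of_nonneg_left (h1.trans_eq h2) (by positivity)
      _ = Real.logb 2 (m : ℝ) / (k : ℝ) ^ 4 := by
          field_simp
  calc ⌊1 / (4 * (k : ℝ) ^ 4) * Real.logb 2 (n : ℝ)⌋₊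
      ≤ ⌊Real.logb 2 (m : ℝ) / ((k ^ 4 : ℕ) : ℝ)⌋₊ := Nat.floor_le_floor h3
    _ = ⌊Real.logb 2 (m : ℝ)⌋₊ / k ^ 4 := Nat.floor_div_natCast _ _
    _ = Nat.log 2 m / k ^ 4 := by
        have h := Real.natFloor_logb_natCast 2 m
        rw [Nat.cast_ofNat] at h
        rw [h]

/-- **Size comparison**: `n^c + 2 ≤ m^{4c+4}` for `2 ≤ m`, `n ≤ m⁴`. [folklore] -/
theorem pow_add_two_le_pow {m n c : ℕ} (hm : 2 ≤ m) (hn : n ≤ m ^ 4) :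
    n ^ c + 2 ≤ m ^ (4 * c + 4) := by
  have h16 : 16 ≤ m ^ 4 := by
    calc 16 = 2 ^ 4 := by norm_num
      _ ≤ m ^ 4 := Nat.pow_le_pow_left hm 4
  have hnc : n ^ c ≤ (m ^ 4) ^ c := Nat.pow_le_pow_left hn c
  have h1 : 1 ≤ (m ^ 4) ^ c := Nat.one_le_pow _ _ (by omega)
  rw [pow_add, pow_mul]
  nlinarith

/-- **Size comparison in the reals**: `m^{4c+4} ≤ m^{k/4}` for `k = 16c + 17`, `1 ≤ m`. [folklore] -/
theorem pow_le_rpow_quarter {m c : ℕ} (hm : 1 ≤ m) :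
    ((m ^ (4 * c + 4) : ℕ) : ℝ) ≤ (m : ℝ) ^ (((16 * c + 17 : ℕ) : ℝ) / 4) := by
  have hm1 : (1 : ℝ) ≤ (m : ℝ) := by exact_mod_cast hm
  have hexp : (((4 * c + 4 : ℕ) : ℝ)) ≤ ((16 * c + 17 : ℕ) : ℝ) / 4 := by
    push_cast
    linarith
  rw [Nat.cast_pow, ← Real.rpow_natCast]
  exact Real.rpow_le_rpow_of_exponent_le hm1 hexp

/-! ## The rung -/

/-- **R9-A′ in uniform form**: ONE `NP` language (the recurring-clique language) such that for every
polynomial `n^c` there is an `ε > 0` (`ε = 1/(4(16c+17)⁴)`) with: infinitely often the slice is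
monotone and De Morgan circuits with `⌊ε·log₂ n⌋` NOT gates for it need more than `n^c` gates.
[cite: Rossman2015, Lemma 1.3] -/
theorem neglimitedPolyVsEpsLogNegations_uniform :
    ∃ L ∈ Literature.Computability.Complexity.Nondeterministic.NP, ∀ c : ℕ, ∃ ε : ℝ, 0 < ε ∧
      ∃ᶠ n : ℕ in atTop, Monotone (L.sliceFn n) ∧
        n ^ c < negLimitedSizeOver deMorganBasis ⌊ε * Real.logb 2 n⌋₊ (L.sliceFn n) := by
  refine ⟨recCliqueLang, recCliqueLang_mem_NP, fun c => ?_⟩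
  refine ⟨1 / (4 * ((16 * c + 17 : ℕ) : ℝ) ^ 4), by positivity, ?_⟩
  obtain ⟨m₁, hm₁⟩ := eventually_atTop.1 (neglimitedCliqueFixedK_holds (16 * c + 17) (by omega))
  refine frequently_atTop.2 fun n₀ => ?_
  -- the number of vertices: beyond `n₀`, beyond the engine's threshold, and above `k = 16c + 17`
  obtain ⟨m, hmn₀, hmm₁, hmk⟩ : ∃ m : ℕ, n₀ ≤ m ∧ m₁ ≤ m ∧ 16 * c + 17 < m :=
    ⟨max (max n₀ m₁) (16 * c + 18), le_trans (le_max_left _ _) (le_max_left _ _),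
      le_trans (le_max_right _ _) (le_max_left _ _),
      Nat.lt_of_lt_of_le (Nat.lt_succ_self _) (le_max_right _ _)⟩
  have hm2 : 2 ≤ m := by omega
  have hn4 : m * m + (16 * c + 17) ≤ m ^ 4 := sq_add_le_pow_four hm2 hmk
  refine ⟨m * m + (16 * c + 17), hmn₀.trans ((Nat.le_mul_self m).trans (Nat.le_add_right _ _)),
    monotone_sliceFn_recCliqueLang (by omega) hmk, ?_⟩
  -- every admissible circuit for `CLIQUE(m, 16c+17)` at this budget has more than `n^c` gates
  refine Nat.lt_of_succ_le (le_negLimitedSizeOver_sliceFn_recClique (by omega) hmk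
    fun D hD hcomp hneg => ?_)
  have hbud : D.negationCount ≤ Nat.log 2 m / (16 * c + 17) ^ 4 :=
    hneg.trans (floor_eps_logb_le_log_div (by omega) hn4)
  have hlt := hm₁ m hmm₁ D hD hcomp hbud
  have hle : (((m * m + (16 * c + 17)) ^ c + 2 : ℕ) : ℝ) < (D.size : ℝ) + 1 :=
    calc (((m * m + (16 * c + 17)) ^ c + 2 : ℕ) : ℝ)
        ≤ ((m ^ (4 * c + 4) : ℕ) : ℝ) := by exact_mod_cast pow_add_two_le_pow hm2 hn4
      _ ≤ (m : ℝ) ^ (((16 * c + 17 : ℕ) : ℝ) / 4) := pow_le_rpow_quarter (by omega)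
      _ < (D.size : ℝ) + 1 := hlt
  have hle' : (m * m + (16 * c + 17)) ^ c + 2 < D.size + 1 := by exact_mod_cast hle
  omega

/-- **The rung `NeglimitedPolyVsEpsLogNegations` (R9-A′) PROVED**: `Ω(log n)` negations against each
fixed polynomial, for an explicit `NP` language with monotone slices. [cite: Rossman2015, Lemma 1.3] -/
theorem neglimitedPolyVsEpsLogNegations_holds : NeglimitedPolyVsEpsLogNegations := by
  obtain ⟨L, hL, h⟩ := neglimitedPolyVsEpsLogNegations_uniform
  exact fun c => ⟨L, hL, h c⟩

end Summit.PneNP.PneNP.Theorems.NegLimitedLadder
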